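import Mathlib
import Literature.AlgebraicGeometry.Resolution.PolygonInvariantsIndexed
import HarnessLib

/-!
# The scaled polygon invariants as functions of a SET of lattice points: rescaling and unions (for standard bases with several generators)

Topic: `Literature/AlgebraicGeometry/Resolution`. Cossart–Jannsen–Saito, LNM 2270, **Def. 8.5** / **Lemma 8.6**: for a system `f = (f₁, …, f_m)` the polyhedron
`Δ(f, y, u)` is the smallest F-subset containing `⋃ᵢ Δ(fᵢ, y, u)`, `δ_L(f, y, u) = minᵢ δ_L(fᵢ, y, u)`, and all essential points lie in `(1/d!) ℤ^e`, `d = max nᵢ`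
(«`Ṽ(f, y, u) ⊂ (1/d!) ℤ^e_{≥0}` … In particular `Ṽ(f, y, u)` is a finite set»). The tree's engine (`PolygonInvariantsIndexed`) computes the scaled invariants
`δ α β ε ζ γ±` (Def. 11.1) of ONE idealistic exponent `(J, μ)` from its Newton points `pts c J μ` scaled by `μ!`; for a standard basis one applies it per generator
(`J := span{fᵢ}`, `μ := nᵢ`; memo `run/shared/lean/pub/res-hironaka/L/res-L1-w42-stub-3/KEYCLAIM-PORT-PLAN.md` §6.2′) and combines over `i` after rescaling to the
common denominator `d!`. This file is that bookkeeping, stated once for an arbitrary set `S ⊆ ℕ × ℕ` of (scaled) points (ns `WeightedOrder`; no facts):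

* `deltaP alphaP betaP epsP zetaP gammaMinusP gammaPlusP S` — the invariants of Def. 11.1 of a point set (`sInf`/`sSup` over `ℕ`), attainment for nonempty `S`
  (`exists_deltaP`, `exists_vP`, `exists_wP`, `exists_wMinusP`, `exists_wPlusP`) and the lower/upper-bound lemmas;
* `sptSet c J μ` and **compatibility** `deltaS_eq_deltaP … gammaPlusS_eq_gammaPlusP` with `PolygonInvariantsIndexed`;
* **rescaling** `scalePt k`: `deltaP_scale`, `alphaP_scale`, `betaP_scale`, `epsP_scale`, `zetaP_scale` (`k > 0`);
* **unions** (Def. 8.5 (3)): `deltaP_union`, `alphaP_union`, `epsP_union` (`= min`), and the lexicographic ones `betaP_union_of_lt`, `betaP_union_of_eq`,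
  `zetaP_union_of_lt`, `zetaP_union_of_eq`, `gammaMinusP_union_of_lt`, `gammaMinusP_union_of_eq`.

Sources: V. Cossart, U. Jannsen, S. Saito, LNM **2270** (2020), Def. 8.1 (2)–(3), Def. 8.5, Lemma 8.6, Def. 11.1 [`CossartJannsenSaito2020`]; V. Cossart, O. Piltant,
J. Algebra 320 (2008), §4 (14) [`CossartPiltant2008`]. AI-written; weaker than expert review. No named facts; no instance, notation or attribute.
-/

noncomputable section

open IsLocalRing

namespace Literature.AlgebraicGeometry.Resolution

namespace WeightedOrder

universe u

/-! ## Invariants of a set of lattice points -/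

section PointSet

variable (S : Set (ℕ × ℕ))

/-- `δ(S) = min {x₁ + x₂}`. [cite: CossartJannsenSaito2020, Def. 8.1 (3)] -/
def deltaP : ℕ := sInf ((fun p : ℕ × ℕ => p.1 + p.2) '' S)

/-- `α(S) = min x₁`. [cite: CossartJannsenSaito2020, Def. 11.1] -/
def alphaP : ℕ := sInf (Prod.fst '' S)

/-- `β(S) = min {x₂ : x₁ = α}`. [cite: CossartJannsenSaito2020, Def. 11.1] -/
def betaP : ℕ := sInf (Prod.snd '' {p | p ∈ S ∧ p.1 = alphaP S})

/-- `ε(S) = min x₂`. [cite: CossartJannsenSaito2020, Def. 11.1] -/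
def epsP : ℕ := sInf (Prod.snd '' S)

/-- `ζ(S) = min {x₁ : x₂ = ε}`. [cite: CossartJannsenSaito2020, Def. 11.1] -/
def zetaP : ℕ := sInf (Prod.fst '' {p | p ∈ S ∧ p.2 = epsP S})

/-- `γ⁻(S) = min {x₂ : x₁ + x₂ = δ}`. [cite: CossartJannsenSaito2020, Def. 11.1] -/
def gammaMinusP : ℕ := sInf (Prod.snd '' {p | p ∈ S ∧ p.1 + p.2 = deltaP S})

/-- `γ⁺(S) = max {x₂ : x₁ + x₂ = δ}`. [cite: CossartJannsenSaito2020, Def. 11.1] -/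
def gammaPlusP : ℕ := sSup (Prod.snd '' {p | p ∈ S ∧ p.1 + p.2 = deltaP S})

variable {S}

/-- `δ` is a lower bound. [cite: CossartJannsenSaito2020, Def. 8.1 (3)] -/
theorem deltaP_le {p : ℕ × ℕ} (hp : p ∈ S) : deltaP S ≤ p.1 + p.2 := Nat.sInf_le ⟨p, hp, rfl⟩

/-- `δ` is attained. [cite: CossartJannsenSaito2020, Def. 8.1 (3)] -/
theorem exists_deltaP (hne : S.Nonempty) : ∃ p ∈ S, p.1 + p.2 = deltaP S := by
  obtain ⟨p, hp, h⟩ := (Set.mem_image _ _ _).mp (Nat.sInf_mem (hne.image fun p : ℕ × ℕ => p.1 + p.2))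
  exact ⟨p, hp, h⟩

/-- `α` is a lower bound. [cite: CossartJannsenSaito2020, Def. 11.1] -/
theorem alphaP_le {p : ℕ × ℕ} (hp : p ∈ S) : alphaP S ≤ p.1 := Nat.sInf_le ⟨p, hp, rfl⟩

/-- `α` is attained. [cite: CossartJannsenSaito2020, Def. 11.1] -/
theorem exists_alphaP (hne : S.Nonempty) : ∃ p ∈ S, p.1 = alphaP S := by
  obtain ⟨p, hp, h⟩ := (Set.mem_image _ _ _).mp (Nat.sInf_mem (hne.image Prod.fst))
  exact ⟨p, hp, h⟩

/-- `β` is a lower bound on the line `x₁ = α`. [cite: CossartJannsenSaito2020, Def. 11.1] -/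
theorem betaP_le {p : ℕ × ℕ} (hp : p ∈ S) (h1 : p.1 = alphaP S) : betaP S ≤ p.2 := Nat.sInf_le ⟨p, ⟨hp, h1⟩, rfl⟩

/-- The vertex `v = (α, β)` is attained. [cite: CossartJannsenSaito2020, Def. 11.1] -/
theorem exists_vP (hne : S.Nonempty) : ∃ p ∈ S, p.1 = alphaP S ∧ p.2 = betaP S := by
  obtain ⟨p₀, hp₀, h₀⟩ := exists_alphaP hne
  have hne' : ({p | p ∈ S ∧ p.1 = alphaP S}).Nonempty := ⟨p₀, hp₀, h₀⟩
  obtain ⟨p, ⟨hp, h1⟩, h2⟩ := (Set.mem_image _ _ _).mp (Nat.sInf_mem (hne'.image Prod.snd))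
  exact ⟨p, hp, h1, h2⟩

/-- `ε` is a lower bound. [cite: CossartJannsenSaito2020, Def. 11.1] -/
theorem epsP_le {p : ℕ × ℕ} (hp : p ∈ S) : epsP S ≤ p.2 := Nat.sInf_le ⟨p, hp, rfl⟩

/-- `ε` is attained. [cite: CossartJannsenSaito2020, Def. 11.1] -/
theorem exists_epsP (hne : S.Nonempty) : ∃ p ∈ S, p.2 = epsP S := by
  obtain ⟨p, hp, h⟩ := (Set.mem_image _ _ _).mp (Nat.sInf_mem (hne.image Prod.snd))
  exact ⟨p, hp, h⟩

/-- `ζ` is a lower bound on the line `x₂ = ε`. [cite: CossartJannsenSaito2020, Def. 11.1] -/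
theorem zetaP_le {p : ℕ × ℕ} (hp : p ∈ S) (h2 : p.2 = epsP S) : zetaP S ≤ p.1 := Nat.sInf_le ⟨p, ⟨hp, h2⟩, rfl⟩

/-- The vertex `w = (ζ, ε)` is attained. [cite: CossartJannsenSaito2020, Def. 11.1] -/
theorem exists_wP (hne : S.Nonempty) : ∃ p ∈ S, p.2 = epsP S ∧ p.1 = zetaP S := by
  obtain ⟨p₀, hp₀, h₀⟩ := exists_epsP hne
  have hne' : ({p | p ∈ S ∧ p.2 = epsP S}).Nonempty := ⟨p₀, hp₀, h₀⟩
  obtain ⟨p, ⟨hp, h2⟩, h1⟩ := (Set.mem_image _ _ _).mp (Nat.sInf_mem (hne'.image Prod.fst))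
  exact ⟨p, hp, h2, h1⟩

/-- `γ⁻` is a lower bound on the `δ`-line. [cite: CossartJannsenSaito2020, Def. 11.1] -/
theorem gammaMinusP_le {p : ℕ × ℕ} (hp : p ∈ S) (h : p.1 + p.2 = deltaP S) : gammaMinusP S ≤ p.2 := Nat.sInf_le ⟨p, ⟨hp, h⟩, rfl⟩

/-- The vertex `w⁻ = (δ − γ⁻, γ⁻)` is attained. [cite: CossartJannsenSaito2020, Def. 11.1] -/
theorem exists_wMinusP (hne : S.Nonempty) : ∃ p ∈ S, p.1 + p.2 = deltaP S ∧ p.2 = gammaMinusP S := by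
  obtain ⟨p₀, hp₀, h₀⟩ := exists_deltaP hne
  have hne' : ({p | p ∈ S ∧ p.1 + p.2 = deltaP S}).Nonempty := ⟨p₀, hp₀, h₀⟩
  obtain ⟨p, ⟨hp, h1⟩, h2⟩ := (Set.mem_image _ _ _).mp (Nat.sInf_mem (hne'.image Prod.snd))
  exact ⟨p, hp, h1, h2⟩

/-- The ordinates on the `δ`-line are bounded by `δ`. [cite: CossartJannsenSaito2020, Def. 11.1] -/
theorem bddAbove_deltaLineP : BddAbove (Prod.snd '' {p | p ∈ S ∧ p.1 + p.2 = deltaP S}) := by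
  refine ⟨deltaP S, ?_⟩
  rintro _ ⟨p, ⟨-, h⟩, rfl⟩
  omega

/-- `γ⁺` is an upper bound on the `δ`-line. [cite: CossartJannsenSaito2020, Def. 11.1] -/
theorem le_gammaPlusP {p : ℕ × ℕ} (hp : p ∈ S) (h : p.1 + p.2 = deltaP S) : p.2 ≤ gammaPlusP S :=
  le_csSup bddAbove_deltaLineP ⟨p, ⟨hp, h⟩, rfl⟩

/-- The vertex `w⁺ = (δ − γ⁺, γ⁺)` is attained. [cite: CossartJannsenSaito2020, Def. 11.1] -/
theorem exists_wPlusP (hne : S.Nonempty) : ∃ p ∈ S, p.1 + p.2 = deltaP S ∧ p.2 = gammaPlusP S := by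
  obtain ⟨p₀, hp₀, h₀⟩ := exists_deltaP hne
  have hne' : ({p | p ∈ S ∧ p.1 + p.2 = deltaP S}).Nonempty := ⟨p₀, hp₀, h₀⟩
  obtain ⟨p, ⟨hp, h1⟩, h2⟩ := (Set.mem_image _ _ _).mp (Nat.sSup_mem (hne'.image Prod.snd) bddAbove_deltaLineP)
  exact ⟨p, hp, h1, h2⟩

/-- `γ⁻ ≤ γ⁺` for nonempty `S`. [cite: CossartJannsenSaito2020, (11.1)] -/
theorem gammaMinusP_le_gammaPlusP (hne : S.Nonempty) : gammaMinusP S ≤ gammaPlusP S := by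
  obtain ⟨p, hp, h1, h2⟩ := exists_wMinusP hne
  rw [← h2]; exact le_gammaPlusP hp h1

/-- `δ ≤ α + β`. [cite: CossartJannsenSaito2020, (11.1)] -/
theorem deltaP_le_alphaP_add_betaP (hne : S.Nonempty) : deltaP S ≤ alphaP S + betaP S := by
  obtain ⟨p, hp, h1, h2⟩ := exists_vP hne
  rw [← h1, ← h2]; exact deltaP_le hp

/-- `α ≤ ζ` and `ε ≤ β`. [cite: CossartJannsenSaito2020, (11.1)] -/
theorem alphaP_le_zetaP_and_epsP_le_betaP (hne : S.Nonempty) : alphaP S ≤ zetaP S ∧ epsP S ≤ betaP S := by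
  obtain ⟨p, hp, -, h1⟩ := exists_wP hne
  obtain ⟨q, hq, -, h2⟩ := exists_vP hne
  exact ⟨h1 ▸ alphaP_le hp, h2 ▸ epsP_le hq⟩

end PointSet

/-! ## Compatibility with the invariants of one idealistic exponent `(J, μ)` -/

section Compat

variable {R : Type u} [CommRing R] {r : ℕ} (c : Fin (r + 2) → R) (J : Ideal R) (μ : ℕ)

/-- The set of scaled Newton points `{(spt₁ e, spt₂ e) : e ∈ pts c J μ}`. [cite: CossartJannsenSaito2020, Def. 8.2 (1)] [cite: CossartPiltant2008, §4 (14)] -/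
def sptSet : Set (ℕ × ℕ) := (fun e => (spt₁ μ e, spt₂ μ e)) '' pts c J μ

/-- `sptSet` is nonempty iff `pts` is. [cite: CossartJannsenSaito2020, Def. 8.2 (1)] -/
theorem sptSet_nonempty_iff : (sptSet c J μ).Nonempty ↔ (pts c J μ).Nonempty := Set.image_nonempty

/-- The fibre conditions transfer: `{p ∈ sptSet | P p} = image of {e ∈ pts | P (spt e)}`. [cite: CossartJannsenSaito2020, Def. 11.1] -/
theorem sep_sptSet_eq (P : ℕ × ℕ → Prop) :
    {p | p ∈ sptSet c J μ ∧ P p} = (fun e => (spt₁ μ e, spt₂ μ e)) '' {e | e ∈ pts c J μ ∧ P (spt₁ μ e, spt₂ μ e)} := by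
  ext p
  constructor
  · rintro ⟨⟨e, he, rfl⟩, hP⟩; exact ⟨e, ⟨he, hP⟩, rfl⟩
  · rintro ⟨e, ⟨he, hP⟩, rfl⟩; exact ⟨⟨e, he, rfl⟩, hP⟩

/-- `δs(J, μ) = δ(sptSet)`. [cite: CossartJannsenSaito2020, Def. 11.1] -/
theorem deltaS_eq_deltaP : deltaS c J μ = deltaP (sptSet c J μ) := by
  rw [deltaP, sptSet, Set.image_image]; rfl

/-- `αs(J, μ) = α(sptSet)`. [cite: CossartJannsenSaito2020, Def. 11.1] -/
theorem alphaS_eq_alphaP : alphaS c J μ = alphaP (sptSet c J μ) := by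
  rw [alphaP, sptSet, Set.image_image]; rfl

/-- `βs(J, μ) = β(sptSet)`. [cite: CossartJannsenSaito2020, Def. 11.1] -/
theorem betaS_eq_betaP : betaS c J μ = betaP (sptSet c J μ) := by
  rw [betaP, sep_sptSet_eq, Set.image_image, ← alphaS_eq_alphaP]; rfl

/-- `εs(J, μ) = ε(sptSet)`. [cite: CossartJannsenSaito2020, Def. 11.1] -/
theorem epsS_eq_epsP : epsS c J μ = epsP (sptSet c J μ) := by
  rw [epsP, sptSet, Set.image_image]; rfl

/-- `ζs(J, μ) = ζ(sptSet)`. [cite: CossartJannsenSaito2020, Def. 11.1] -/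
theorem zetaS_eq_zetaP : zetaS c J μ = zetaP (sptSet c J μ) := by
  rw [zetaP, sep_sptSet_eq, Set.image_image, ← epsS_eq_epsP]; rfl

/-- `γ⁻s(J, μ) = γ⁻(sptSet)`. [cite: CossartJannsenSaito2020, Def. 11.1] -/
theorem gammaMinusS_eq_gammaMinusP : gammaMinusS c J μ = gammaMinusP (sptSet c J μ) := by
  rw [gammaMinusP, sep_sptSet_eq, Set.image_image, ← deltaS_eq_deltaP]; rfl

/-- `γ⁺s(J, μ) = γ⁺(sptSet)`. [cite: CossartJannsenSaito2020, Def. 11.1] -/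
theorem gammaPlusS_eq_gammaPlusP : gammaPlusS c J μ = gammaPlusP (sptSet c J μ) := by
  rw [gammaPlusP, sep_sptSet_eq, Set.image_image, ← deltaS_eq_deltaP]; rfl

end Compat

/-! ## Rescaling to a common denominator (CJS Lemma 8.6) -/

section Scale

variable {S : Set (ℕ × ℕ)} {k : ℕ}

/-- Rescaling a lattice point by `k` (from the denominator `nᵢ!` to `d!`, `k = d!/nᵢ!`). [cite: CossartJannsenSaito2020, Lemma 8.6] -/
def scalePt (k : ℕ) (p : ℕ × ℕ) : ℕ × ℕ := (k * p.1, k * p.2)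

/-- `sInf` commutes with multiplication by `k` on sets of naturals. [cite: CossartJannsenSaito2020, Lemma 8.6] -/
theorem sInf_image_mul (T : Set ℕ) (k : ℕ) : sInf ((fun x => k * x) '' T) = k * sInf T := by
  rcases T.eq_empty_or_nonempty with rfl | hT
  · simp
  refine le_antisymm (Nat.sInf_le ⟨sInf T, Nat.sInf_mem hT, rfl⟩) ?_
  obtain ⟨x, hx, h⟩ := (Set.mem_image _ _ _).mp (Nat.sInf_mem (hT.image fun x => k * x))
  rw [← h]
  exact Nat.mul_le_mul_left k (Nat.sInf_le hx)

/-- `δ(k S) = k δ(S)`. [cite: CossartJannsenSaito2020, Lemma 8.6, Def. 8.5 (3)] -/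
theorem deltaP_scale (S : Set (ℕ × ℕ)) (k : ℕ) : deltaP (scalePt k '' S) = k * deltaP S := by
  rw [deltaP, deltaP, Set.image_image, ← sInf_image_mul, Set.image_image]
  congr 1
  refine Set.image_congr' fun p => ?_
  simp [scalePt, Nat.mul_add]

/-- `α(k S) = k α(S)`. [cite: CossartJannsenSaito2020, Lemma 8.6] -/
theorem alphaP_scale (S : Set (ℕ × ℕ)) (k : ℕ) : alphaP (scalePt k '' S) = k * alphaP S := by
  rw [alphaP, alphaP, Set.image_image, ← sInf_image_mul, Set.image_image]; rfl

/-- `ε(k S) = k ε(S)`. [cite: CossartJannsenSaito2020, Lemma 8.6] -/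
theorem epsP_scale (S : Set (ℕ × ℕ)) (k : ℕ) : epsP (scalePt k '' S) = k * epsP S := by
  rw [epsP, epsP, Set.image_image, ← sInf_image_mul, Set.image_image]; rfl

/-- The fibre conditions rescale (for `k > 0`). [cite: CossartJannsenSaito2020, Lemma 8.6] -/
theorem sep_scale_eq (hk : 0 < k) (S : Set (ℕ × ℕ)) (P : ℕ × ℕ → Prop) :
    {p | p ∈ scalePt k '' S ∧ P p} = scalePt k '' {p | p ∈ S ∧ P (scalePt k p)} := by
  have _ := hk
  ext p
  constructor
  · rintro ⟨⟨q, hq, rfl⟩, hP⟩; exact ⟨q, ⟨hq, hP⟩, rfl⟩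
  · rintro ⟨q, ⟨hq, hP⟩, rfl⟩; exact ⟨⟨q, hq, rfl⟩, hP⟩

/-- `β(k S) = k β(S)` (`k > 0`). [cite: CossartJannsenSaito2020, Lemma 8.6] -/
theorem betaP_scale (hk : 0 < k) (S : Set (ℕ × ℕ)) : betaP (scalePt k '' S) = k * betaP S := by
  rw [betaP, betaP, sep_scale_eq hk, alphaP_scale, Set.image_image, ← sInf_image_mul, Set.image_image]
  congr 1
  apply congrArg
  ext p
  simp only [Set.mem_setOf_eq, scalePt]
  exact and_congr_right fun _ => Nat.mul_right_inj hk.ne'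

/-- `ζ(k S) = k ζ(S)` (`k > 0`). [cite: CossartJannsenSaito2020, Lemma 8.6] -/
theorem zetaP_scale (hk : 0 < k) (S : Set (ℕ × ℕ)) : zetaP (scalePt k '' S) = k * zetaP S := by
  rw [zetaP, zetaP, sep_scale_eq hk, epsP_scale, Set.image_image, ← sInf_image_mul, Set.image_image]
  congr 1
  apply congrArg
  ext p
  simp only [Set.mem_setOf_eq, scalePt]
  exact and_congr_right fun _ => Nat.mul_right_inj hk.ne'

/-- `γ⁻(k S) = k γ⁻(S)` (`k > 0`). [cite: CossartJannsenSaito2020, Lemma 8.6] -/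
theorem gammaMinusP_scale (hk : 0 < k) (S : Set (ℕ × ℕ)) : gammaMinusP (scalePt k '' S) = k * gammaMinusP S := by
  rw [gammaMinusP, gammaMinusP, sep_scale_eq hk, deltaP_scale, Set.image_image, ← sInf_image_mul, Set.image_image]
  congr 1
  apply congrArg
  ext p
  simp only [Set.mem_setOf_eq, scalePt, ← Nat.mul_add]
  exact and_congr_right fun _ => Nat.mul_right_inj hk.ne'

end Scale

/-! ## Unions (CJS Def. 8.5 (3)) -/

section Union

variable {S T : Set (ℕ × ℕ)}

/-- `sInf` of a union of nonempty sets of naturals is the minimum. [cite: CossartJannsenSaito2020, Def. 8.5 (3)] -/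
theorem sInf_union_nat {A B : Set ℕ} (hA : A.Nonempty) (hB : B.Nonempty) : sInf (A ∪ B) = min (sInf A) (sInf B) :=
  csInf_union (OrderBot.bddBelow A) hA (OrderBot.bddBelow B) hB

/-- **`δ(S ∪ T) = min (δ S) (δ T)`.** [cite: CossartJannsenSaito2020, Def. 8.5 (3)] -/
theorem deltaP_union (hS : S.Nonempty) (hT : T.Nonempty) : deltaP (S ∪ T) = min (deltaP S) (deltaP T) := by
  rw [deltaP, Set.image_union, sInf_union_nat (hS.image _) (hT.image _)]; rfl

/-- **`α(S ∪ T) = min (α S) (α T)`.** [cite: CossartJannsenSaito2020, Def. 8.5 (3), Def. 11.1] -/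
theorem alphaP_union (hS : S.Nonempty) (hT : T.Nonempty) : alphaP (S ∪ T) = min (alphaP S) (alphaP T) := by
  rw [alphaP, Set.image_union, sInf_union_nat (hS.image _) (hT.image _)]; rfl

/-- **`ε(S ∪ T) = min (ε S) (ε T)`.** [cite: CossartJannsenSaito2020, Def. 8.5 (3), Def. 11.1] -/
theorem epsP_union (hS : S.Nonempty) (hT : T.Nonempty) : epsP (S ∪ T) = min (epsP S) (epsP T) := by
  rw [epsP, Set.image_union, sInf_union_nat (hS.image _) (hT.image _)]; rfl

/-- A lexicographic second minimum over a union, when the first minimum is attained only on the left: generic form.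
[cite: CossartJannsenSaito2020, Def. 11.1] -/
theorem sInf_sep_union_of_forall_not {g : ℕ × ℕ → ℕ} {P : ℕ × ℕ → Prop} (hT : ∀ p ∈ T, ¬ P p) :
    sInf (g '' {p | p ∈ S ∪ T ∧ P p}) = sInf (g '' {p | p ∈ S ∧ P p}) := by
  congr 2
  ext p
  simp only [Set.mem_setOf_eq, Set.mem_union]
  constructor
  · rintro ⟨hp | hp, hP⟩
    · exact ⟨hp, hP⟩
    · exact absurd hP (hT p hp)
  · rintro ⟨hp, hP⟩; exact ⟨Or.inl hp, hP⟩

/-- A lexicographic second minimum over a union when the first minimum is attained on both sides: generic form.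
[cite: CossartJannsenSaito2020, Def. 11.1] -/
theorem sInf_sep_union_of_nonempty {g : ℕ × ℕ → ℕ} {P : ℕ × ℕ → Prop} (hS : ({p | p ∈ S ∧ P p}).Nonempty)
    (hT : ({p | p ∈ T ∧ P p}).Nonempty) :
    sInf (g '' {p | p ∈ S ∪ T ∧ P p}) = min (sInf (g '' {p | p ∈ S ∧ P p})) (sInf (g '' {p | p ∈ T ∧ P p})) := by
  rw [← sInf_union_nat (hS.image g) (hT.image g), ← Set.image_union]
  congr 2
  ext p
  simp only [Set.mem_setOf_eq, Set.mem_union]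
  tauto

/-- **`β(S ∪ T) = β(S)` when `α(S) < α(T)`.** [cite: CossartJannsenSaito2020, Def. 11.1] -/
theorem betaP_union_of_lt (hS : S.Nonempty) (hT : T.Nonempty) (h : alphaP S < alphaP T) : betaP (S ∪ T) = betaP S := by
  have hα : alphaP (S ∪ T) = alphaP S := by rw [alphaP_union hS hT, min_eq_left h.le]
  rw [betaP, betaP, hα]
  exact sInf_sep_union_of_forall_not fun p hp hp1 => absurd (alphaP_le hp) (by omega)

/-- **`β(S ∪ T) = min (β S) (β T)` when `α(S) = α(T)`.** [cite: CossartJannsenSaito2020, Def. 11.1] -/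
theorem betaP_union_of_eq (hS : S.Nonempty) (hT : T.Nonempty) (h : alphaP S = alphaP T) :
    betaP (S ∪ T) = min (betaP S) (betaP T) := by
  have hα : alphaP (S ∪ T) = alphaP S := by rw [alphaP_union hS hT, h, min_self]
  rw [betaP, betaP, betaP, hα]
  obtain ⟨p, hp, hp1⟩ := exists_alphaP hS
  obtain ⟨q, hq, hq1⟩ := exists_alphaP hT
  rw [sInf_sep_union_of_nonempty ⟨p, hp, hp1⟩ ⟨q, hq, by rw [hq1, h]⟩, h]

/-- **`ζ(S ∪ T) = ζ(S)` when `ε(S) < ε(T)`.** [cite: CossartJannsenSaito2020, Def. 11.1] -/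
theorem zetaP_union_of_lt (hS : S.Nonempty) (hT : T.Nonempty) (h : epsP S < epsP T) : zetaP (S ∪ T) = zetaP S := by
  have hε : epsP (S ∪ T) = epsP S := by rw [epsP_union hS hT, min_eq_left h.le]
  rw [zetaP, zetaP, hε]
  exact sInf_sep_union_of_forall_not fun p hp hp2 => absurd (epsP_le hp) (by omega)

/-- **`ζ(S ∪ T) = min (ζ S) (ζ T)` when `ε(S) = ε(T)`.** [cite: CossartJannsenSaito2020, Def. 11.1] -/
theorem zetaP_union_of_eq (hS : S.Nonempty) (hT : T.Nonempty) (h : epsP S = epsP T) :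
    zetaP (S ∪ T) = min (zetaP S) (zetaP T) := by
  have hε : epsP (S ∪ T) = epsP S := by rw [epsP_union hS hT, h, min_self]
  rw [zetaP, zetaP, zetaP, hε]
  obtain ⟨p, hp, hp2⟩ := exists_epsP hS
  obtain ⟨q, hq, hq2⟩ := exists_epsP hT
  rw [sInf_sep_union_of_nonempty ⟨p, hp, hp2⟩ ⟨q, hq, by rw [hq2, h]⟩, h]

/-- **`γ⁻(S ∪ T) = γ⁻(S)` when `δ(S) < δ(T)`.** [cite: CossartJannsenSaito2020, Def. 11.1, Def. 8.5 (3)] -/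
theorem gammaMinusP_union_of_lt (hS : S.Nonempty) (hT : T.Nonempty) (h : deltaP S < deltaP T) :
    gammaMinusP (S ∪ T) = gammaMinusP S := by
  have hδ : deltaP (S ∪ T) = deltaP S := by rw [deltaP_union hS hT, min_eq_left h.le]
  rw [gammaMinusP, gammaMinusP, hδ]
  exact sInf_sep_union_of_forall_not fun p hp hp1 => absurd (deltaP_le hp) (by omega)

/-- **`γ⁻(S ∪ T) = min (γ⁻ S) (γ⁻ T)` when `δ(S) = δ(T)`.** [cite: CossartJannsenSaito2020, Def. 11.1, Def. 8.5 (3)] -/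
theorem gammaMinusP_union_of_eq (hS : S.Nonempty) (hT : T.Nonempty) (h : deltaP S = deltaP T) :
    gammaMinusP (S ∪ T) = min (gammaMinusP S) (gammaMinusP T) := by
  have hδ : deltaP (S ∪ T) = deltaP S := by rw [deltaP_union hS hT, h, min_self]
  rw [gammaMinusP, gammaMinusP, gammaMinusP, hδ]
  obtain ⟨p, hp, hp1⟩ := exists_deltaP hS
  obtain ⟨q, hq, hq1⟩ := exists_deltaP hT
  rw [sInf_sep_union_of_nonempty ⟨p, hp, hp1⟩ ⟨q, hq, by rw [hq1, h]⟩, h]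

end Union

end WeightedOrder

end Literature.AlgebraicGeometry.Resolution

end
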